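import Summits.AtomisticToContinuum.HydrodynamicLimit.Theses.LimitCollisionMeasure
import Summits.AtomisticToContinuum.HydrodynamicLimit.Theorems.InformationPercolationEngineChaosClosesEulerQuantitativeRigidityA
import Summits.AtomisticToContinuum.HydrodynamicLimit.Theorems.InformationPercolationEngineChaosClosesEulerQuantitativeRigidityB
import Summits.AtomisticToContinuum.HydrodynamicLimit.Theorems.JParityClosureEvenStressEnskogQuadraticTestConvergence
import Summits.AtomisticToContinuum.HydrodynamicLimit.Theorems.JParityClosureEvenStressEnskogVelocityEquilibrationRung0MaxwellianContinuity
import HarnessLib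

/-!
# Quantitative Maxwellian rigidity by compactness — C: assembly by contradiction

Helper for the line `Sketch` of the crux `InformationPercolationEngine.ChaosClosesEuler`
(stmt-AtomisticToContinuum-15141), registered stub `stub_quantitativeRigidity`.

`quantitativeRigidity_aux` is the `let`-free form of the stub: Boltzmann's uniqueness of collision
equilibria (`LimitCollisionMeasure.BalanceRigidity`, stmt-13355), the weak-limit toolkit, the Maxwellian
moments and a balance-determining countable test family `ψᵢ` imply that, given a tail schedule `Lt`, a
mass window `[ρ₁, ρ₂]`, a temperature floor `θ₁ > 0`, a bounded continuous `ψ` and `ε > 0`, some `n` works: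
every finite measure on `ℝ³` in the window obeying the schedule up to `n`, with own temperature `≥ θ₁`
and balance defects `|Bal ψᵢ| ≤ 1/(n+1)` (`i < n`), has its `ψ`-moment within `ε` of that of the Maxwellian
with its own parameters.

Proof by contradiction: a bad sequence `mₙ` has a weakly convergent subsequence (file A: tail schedule ⇒
uniform integrability ⇒ tightness, Prokhorov); the toolkit passes masses, first and second moments and the
balance functional to the limit `μ`, which is therefore balanced on every `ψᵢ`, hence on all bounded
continuous tests, hence (rigidity) a point mass — excluded, its own temperature being `0 < θ₁` (file B) — or
a Maxwellian `M_{ρ,θ,u}` whose parameters are the limits of the own parameters (file B); continuity of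
`(u', θ') ↦ ∫ ψ M_{1,θ',u'}` (`EvenStressEnskog.continuousAt_integral_mul_localMaxwellian`) then forces the
defect `∫ ψ dmₙ − ρₙ ∫ ψ M_{1,θₙ,uₙ}` to tend to `0` along the subsequence, contradicting `> ε`.

References: C. Cercignani, R. Illner, M. Pulvirenti, *The Mathematical Theory of Dilute Gases* (1994), §3.2;
P. Billingsley, *Convergence of Probability Measures* (1999), §5.
-/

noncomputable section

namespace Summit.AtomisticToContinuum.HydrodynamicLimit.Theorems.ChaosClosesEulerQuantitativeRigidity

open scoped BigOperators Topology Classical MeasureTheory ENNReal NNReal InnerProductSpace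
open Filter Set MeasureTheory
open Literature.MathematicalPhysics.KineticTheory
open Literature.Analysis.FluidPDE
open Summit.AtomisticToContinuum.HydrodynamicLimit.Theses

/-- **The Maxwellian pairing is continuous in the parameters along any filter**: for a bounded continuous
`ψ` and `θ > 0`, if `Uᵢ → u` and `Θᵢ → θ` then `∫ ψ M_{1,Θᵢ,Uᵢ} → ∫ ψ M_{1,θ,u}`
(`EvenStressEnskog.continuousAt_integral_mul_localMaxwellian`). [folklore] -/
theorem tendsto_integral_mul_localMaxwellian {ψ : V3 → ℝ} (hψ : Continuous ψ) (hC : ∃ C : ℝ, ∀ v, |ψ v| ≤ C)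
    {ι : Type*} {l : Filter ι} {U : ι → V3} {Θ : ι → ℝ} {u : V3} {θ : ℝ} (hθ : 0 < θ)
    (hU : Tendsto U l (𝓝 u)) (hΘ : Tendsto Θ l (𝓝 θ)) :
    Tendsto (fun i => ∫ v, ψ v * localMaxwellian 1 (Θ i) (U i) v) l
      (𝓝 (∫ v, ψ v * localMaxwellian 1 θ u v)) := by
  obtain ⟨C, hC⟩ := hC
  have hC0 : 0 ≤ C := (abs_nonneg _).trans (hC 0)
  have hcont := EvenStressEnskog.continuousAt_integral_mul_localMaxwellian (F := fun q => ψ q.1)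
    (hψ.comp continuous_fst) ⟨C, fun q => (hC q.1).trans
      (le_mul_of_one_le_right hC0 (by nlinarith [sq_nonneg ‖q.1‖, sq_nonneg ‖q.2.1‖, abs_nonneg q.2.2]))⟩
    u hθ
  have h := hcont.tendsto.comp (hU.prodMk_nhds hΘ)
  simpa only [Function.comp_def] using h

/-- **Quantitative Maxwellian rigidity, `let`-free form.** Under Boltzmann's rigidity of balanced measures,
the weak-limit toolkit, the Maxwellian moment identities and a balance-determining family `ψᵢ` bounded by
`1`: for every tail schedule, mass window, temperature floor `θ₁ > 0`, bounded continuous `ψ` and `ε > 0`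
there is `n` such that every finite measure on `ℝ³` with `|v|²` integrable, mass in the window, scheduled
tails up to `n`, own temperature `≥ θ₁` and balance defects `≤ 1/(n+1)` on `ψ₀, …, ψₙ₋₁` has
`|∫ ψ dm − m(ℝ³) ∫ ψ M_{1,θ(m),u(m)}| ≤ ε` (compactness and contradiction). [folklore] -/
theorem quantitativeRigidity_aux (hBR : LimitCollisionMeasure.BalanceRigidity)
    (hWL : ∀ (μs : ℕ → FiniteMeasure V3) (μ : FiniteMeasure V3), Tendsto μs atTop (𝓝 μ) →
      (∀ n, Integrable (fun v : V3 => ‖v‖ ^ 2) (μs n : Measure V3)) →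
      (∀ ε : ℝ, 0 < ε → ∃ L : ℝ, ∀ n, ∫ v in {v : V3 | L < ‖v‖}, ‖v‖ ^ 2 ∂(μs n : Measure V3) ≤ ε) →
      let Bal : (V3 → ℝ) → Measure V3 → ℝ := fun ψ m =>
        ∫ v, ∫ w, ∫ ω : Metric.sphere (0 : V3) 1,
          hardSphereKernel (v, w) ω * (ψ (collide ω (v, w)).1 + ψ (collide ω (v, w)).2 - ψ v - ψ w) ∂sphereMeasure ∂m ∂m
      Integrable (fun v : V3 => ‖v‖ ^ 2) (μ : Measure V3) ∧
      Tendsto (fun n => ((μs n : Measure V3) Set.univ).toReal) atTop (𝓝 ((μ : Measure V3) Set.univ).toReal) ∧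
      (∀ j : Fin 3, Tendsto (fun n => ∫ v, v j ∂(μs n : Measure V3)) atTop (𝓝 (∫ v, v j ∂(μ : Measure V3)))) ∧
      (∀ j k : Fin 3, Tendsto (fun n => ∫ v, v j * v k ∂(μs n : Measure V3)) atTop
        (𝓝 (∫ v, v j * v k ∂(μ : Measure V3)))) ∧
      Tendsto (fun n => ∫ v, ‖v‖ ^ 2 ∂(μs n : Measure V3)) atTop (𝓝 (∫ v, ‖v‖ ^ 2 ∂(μ : Measure V3))) ∧
      (∀ ψ : V3 → ℝ, Continuous ψ → (∃ C : ℝ, ∀ v, |ψ v| ≤ C) →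
        Tendsto (fun n => Bal ψ (μs n : Measure V3)) atTop (𝓝 (Bal ψ (μ : Measure V3)))))
    (hMM : ∀ (ρ θ : ℝ) (u : V3), 0 < ρ → 0 < θ →
      let m : Measure V3 := volume.withDensity (fun v => ENNReal.ofReal (localMaxwellian ρ θ u v))
      IsFiniteMeasure m ∧ Integrable (fun v : V3 => ‖v‖ ^ 2) m ∧
      (m Set.univ).toReal = ρ ∧ (∀ j : Fin 3, ∫ v, v j ∂m = ρ * u j) ∧
      (∀ j k : Fin 3, ∫ v, v j * v k ∂m = ρ * (u j * u k + if j = k then θ else 0)) ∧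
      (∫ v, ‖v‖ ^ 2 ∂m = ρ * (‖u‖ ^ 2 + 3 * θ)) ∧
      (∀ ψ : V3 → ℝ, Continuous ψ → (∃ C : ℝ, ∀ v, |ψ v| ≤ C) →
        Integrable ψ m ∧ ∫ v, ψ v ∂m = ρ * ∫ v, ψ v * localMaxwellian 1 θ u v))
    {ψs : ℕ → V3 → ℝ} (hψc : ∀ i, Continuous (ψs i)) (hψb : ∀ i v, |ψs i v| ≤ 1)
    (hdet : let Bal : (V3 → ℝ) → Measure V3 → ℝ := fun ψ m =>
        ∫ v, ∫ w, ∫ ω : Metric.sphere (0 : V3) 1,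
          hardSphereKernel (v, w) ω * (ψ (collide ω (v, w)).1 + ψ (collide ω (v, w)).2 - ψ v - ψ w) ∂sphereMeasure ∂m ∂m
      ∀ m : Measure V3, IsFiniteMeasure m → Integrable (fun v : V3 => ‖v‖ ^ 2) m →
        (∀ i, Bal (ψs i) m = 0) →
        ∀ ψ : V3 → ℝ, Continuous ψ → (∃ C : ℝ, ∀ v, |ψ v| ≤ C) → Bal ψ m = 0)
    (Lt : ℕ → ℝ) {ρ₁ ρ₂ θ₁ : ℝ} (hρ₁ : 0 < ρ₁) (hθ₁ : 0 < θ₁) {ψ : V3 → ℝ} (hψ : Continuous ψ)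
    (hC : ∃ C : ℝ, ∀ v, |ψ v| ≤ C) {ε : ℝ} (hε : 0 < ε) :
    ∃ n : ℕ, ∀ m : Measure V3, IsFiniteMeasure m → Integrable (fun v : V3 => ‖v‖ ^ 2) m →
      ρ₁ ≤ (m Set.univ).toReal → (m Set.univ).toReal ≤ ρ₂ →
      (∀ j : ℕ, j ≤ n → ∫ v in {v : V3 | Lt j < ‖v‖}, ‖v‖ ^ 2 ∂m ≤ 1 / ((j : ℝ) + 1)) →
      θ₁ ≤ 2 / 3 * ((∫ v, ‖v‖ ^ 2 / 2 ∂m) / (m Set.univ).toReal -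
          ‖∫ v, v ∂m‖ ^ 2 / (2 * (m Set.univ).toReal ^ 2)) →
      (∀ i : ℕ, i < n → |∫ v, ∫ w, ∫ ω : Metric.sphere (0 : V3) 1,
          hardSphereKernel (v, w) ω *
            (ψs i (collide ω (v, w)).1 + ψs i (collide ω (v, w)).2 - ψs i v - ψs i w)
              ∂sphereMeasure ∂m ∂m| ≤ 1 / ((n : ℝ) + 1)) →
      |(∫ v, ψ v ∂m) - (m Set.univ).toReal * ∫ v, ψ v *
          localMaxwellian 1 (2 / 3 * ((∫ v, ‖v‖ ^ 2 / 2 ∂m) / (m Set.univ).toReal -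
            ‖∫ v, v ∂m‖ ^ 2 / (2 * (m Set.univ).toReal ^ 2))) (((m Set.univ).toReal)⁻¹ • ∫ v, v ∂m) v| ≤ ε := by
  by_contra H
  push Not at H
  choose m hfin hint hlo hhi htail hθ hbal hbad using H
  -- Step 1: compactness — a weakly convergent subsequence with uniformly integrable second moments
  obtain ⟨φ, hφ, μ, hconv, hUI⟩ :=
    exists_subseq_tendsto_of_mass_le_of_tail m hfin hint hρ₁ hlo hhi Lt htail
  -- Step 2: the weak-limit toolkit along the subsequence
  obtain ⟨h2μ, hmass, hP, -, hE, hBalT⟩ :=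
    hWL (fun n => (⟨m (φ n), hfin (φ n)⟩ : FiniteMeasure V3)) μ hconv (fun n => hint (φ n)) hUI
  simp only [FiniteMeasure.toMeasure_mk] at hmass hP hE hBalT
  -- the limit is balanced on the test family, hence on all bounded continuous tests
  have hBal0 : ∀ i, ∫ v, ∫ w, ∫ ω : Metric.sphere (0 : V3) 1,
      hardSphereKernel (v, w) ω *
        (ψs i (collide ω (v, w)).1 + ψs i (collide ω (v, w)).2 - ψs i v - ψs i w)
          ∂sphereMeasure ∂(μ : Measure V3) ∂(μ : Measure V3) = 0 := by
    intro i
    have h1 := hBalT (ψs i) (hψc i) ⟨1, hψb i⟩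
    have h2 : Tendsto (fun n => ∫ v, ∫ w, ∫ ω : Metric.sphere (0 : V3) 1,
        hardSphereKernel (v, w) ω *
          (ψs i (collide ω (v, w)).1 + ψs i (collide ω (v, w)).2 - ψs i v - ψs i w)
            ∂sphereMeasure ∂(m (φ n)) ∂(m (φ n))) atTop (𝓝 0) := by
      refine squeeze_zero_norm' ?_
        ((tendsto_one_div_add_atTop_nhds_zero_nat (𝕜 := ℝ)).comp hφ.tendsto_atTop)
      filter_upwards [eventually_gt_atTop i] with n hn
      rw [Real.norm_eq_abs]
      exact hbal (φ n) i (hn.trans_le (hφ.id_le n))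
    exact tendsto_nhds_unique h1 h2
  have hbalμ := hdet (μ : Measure V3) inferInstance h2μ hBal0
  -- Step 3: limits of the own parameters
  have hρ₁le : ρ₁ ≤ ((μ : Measure V3) Set.univ).toReal := ge_of_tendsto' hmass fun n => hlo (φ n)
  have hρpos : 0 < ((μ : Measure V3) Set.univ).toReal := hρ₁.trans_le hρ₁le
  have hPlim : Tendsto (fun n => ∫ v, v ∂(m (φ n))) atTop (𝓝 (∫ v, v ∂(μ : Measure V3))) :=
    tendsto_integral_id (fun n => integrable_id_of_sq (hint (φ n))) (integrable_id_of_sq h2μ) hP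
  have hElim : Tendsto (fun n => ∫ v, ‖v‖ ^ 2 / 2 ∂(m (φ n))) atTop
      (𝓝 (∫ v, ‖v‖ ^ 2 / 2 ∂(μ : Measure V3))) := by
    simp only [integral_div]
    exact hE.div_const 2
  have hθlim : Tendsto (fun n => 2 / 3 * ((∫ v, ‖v‖ ^ 2 / 2 ∂(m (φ n))) / ((m (φ n)) Set.univ).toReal -
      ‖∫ v, v ∂(m (φ n))‖ ^ 2 / (2 * ((m (φ n)) Set.univ).toReal ^ 2))) atTop
      (𝓝 (2 / 3 * ((∫ v, ‖v‖ ^ 2 / 2 ∂(μ : Measure V3)) / ((μ : Measure V3) Set.univ).toReal -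
        ‖∫ v, v ∂(μ : Measure V3)‖ ^ 2 / (2 * ((μ : Measure V3) Set.univ).toReal ^ 2)))) :=
    ((hElim.div hmass hρpos.ne').sub ((hPlim.norm.pow 2).div ((hmass.pow 2).const_mul 2)
      (by positivity))).const_mul (2 / 3)
  have hθ₁le : θ₁ ≤ 2 / 3 * ((∫ v, ‖v‖ ^ 2 / 2 ∂(μ : Measure V3)) / ((μ : Measure V3) Set.univ).toReal -
      ‖∫ v, v ∂(μ : Measure V3)‖ ^ 2 / (2 * ((μ : Measure V3) Set.univ).toReal ^ 2)) :=
    ge_of_tendsto' hθlim fun n => hθ (φ n)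
  have hulim : Tendsto (fun n => (((m (φ n)) Set.univ).toReal)⁻¹ • ∫ v, v ∂(m (φ n))) atTop
      (𝓝 ((((μ : Measure V3) Set.univ).toReal)⁻¹ • ∫ v, v ∂(μ : Measure V3))) :=
    (hmass.inv₀ hρpos.ne').smul hPlim
  -- Step 4: rigidity of the limit
  rcases hBR (μ : Measure V3) inferInstance h2μ hbalμ with ⟨c, u, hμeq⟩ | ⟨ρ, θ, u, hρ, hθ, hμeq⟩
  · -- a point mass has own temperature `0 < θ₁`: excluded
    rw [hμeq] at hθ₁le
    exact lt_irrefl _ (hθ₁.trans_le (hθ₁le.trans_eq (ownTemperature_dirac c u)))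
  · -- the Maxwellian case: parameters are the limits of the own parameters
    obtain ⟨hfinM, hintM, hmassM, hPM, -, hEM, hψM⟩ := hMM ρ θ u hρ hθ
    haveI := hfinM
    have hPvec : ∫ v, v ∂(volume.withDensity fun v => ENNReal.ofReal (localMaxwellian ρ θ u v)) = ρ • u :=
      integral_id_eq_smul (integrable_id_of_sq hintM) hPM
    obtain ⟨hθM, huM⟩ := ownParams_of_moments hρ hmassM hPvec hEM
    rw [hμeq] at hθlim hulim hmass
    rw [hθM] at hθlim
    rw [huM] at hulim
    rw [hmassM] at hmass
    -- the `ψ`-moments converge to `ρ ∫ ψ M_{1,θ,u}`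
    obtain ⟨C, hC'⟩ := hC
    have hψlim : Tendsto (fun n => ∫ v, ψ v ∂(m (φ n))) atTop (𝓝 (∫ v, ψ v ∂(μ : Measure V3))) := by
      have h := EvenStressEnskog.QuadraticTest.tendsto_integral_of_abs_le hconv hψ hC'
      simpa only [FiniteMeasure.toMeasure_mk] using h
    rw [hμeq, (hψM ψ hψ ⟨C, hC'⟩).2] at hψlim
    -- continuity of the Maxwellian pairing in the parameters
    have hI := tendsto_integral_mul_localMaxwellian hψ ⟨C, hC'⟩ hθ hulim hθlim
    have hfinal := (hψlim.sub (hmass.mul hI)).abs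
    have hle : ε ≤ |(ρ * ∫ v, ψ v * localMaxwellian 1 θ u v) - ρ * ∫ v, ψ v * localMaxwellian 1 θ u v| :=
      ge_of_tendsto' hfinal fun n => (hbad (φ n)).le
    rw [sub_self, abs_zero] at hle
    exact lt_irrefl _ (hε.trans_le hle)

/-! ## Registered sub-goal -/

/-- **Registered sub-goal `stub_quantitativeRigidityC` (helper C of `stub_quantitativeRigidity`): the Maxwellian
pairing `∫ ψ M_{1,Θₙ,Uₙ}` of a bounded continuous `ψ` converges when `Uₙ → u`, `Θₙ → θ > 0`.** [folklore] -/
theorem stub_quantitativeRigidityC : ∀ {ψ : V3 → ℝ}, Continuous ψ → (∃ C : ℝ, ∀ v, |ψ v| ≤ C) → ∀ {U : ℕ → V3} {Θ : ℕ → ℝ} {u : V3} {θ : ℝ}, 0 < θ → Tendsto U atTop (𝓝 u) → Tendsto Θ atTop (𝓝 θ) → Tendsto (fun i => ∫ v, ψ v * localMaxwellian 1 (Θ i) (U i) v) atTop (𝓝 (∫ v, ψ v * localMaxwellian 1 θ u v)) :=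
  fun hψ hC _ _ _ _ hθ hU hΘ => tendsto_integral_mul_localMaxwellian hψ hC hθ hU hΘ

end Summit.AtomisticToContinuum.HydrodynamicLimit.Theorems.ChaosClosesEulerQuantitativeRigidity

end
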